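import Summits.CriticalPhenomena.PercolationContinuityZ3.Theorems.PercNearOneGluingNoHeavyLowerTailAntipodalStrongHarrisGraded
import HarnessLib

/-!
# Graded antipodal sums on multigraphs: loops and parallel edges are additive (reduction to simple graphs)

Helper file for crux `stmt-CriticalPhenomena-4575` (`NoHeavyLowerTail`), unit `prim-gen-kcluster` gen 84
(memo `prim-gen-kcluster/KCLUSTER-gen84.md` §0.1 (a)).  No definitions, no named facts, no sorries.

Graph dictionary for the cube-level identity `AntipodalStrongHarris.gradedSum_insert_of_spanned`.  A finite multigraph is an
edge system `ends : ι → Sym2 V`; the graph of a set `Y` of edge labels is `fromEdgeSet {s | ∃ i ∈ Y, ends i = s}` (loops are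
invisible to `fromEdgeSet`).  The rank `ρ` and the two labelings `g, h` are arbitrary functions of `Y` that depend only on this
graph (hypotheses `hρ`, `hg`, `hh`; e.g. the number of connected components and the terminal reachability patterns of the
Aas–Gladkov sum, or any other graph invariants).

**Theorem** (`gradedSum_insert_of_parallel`, `gradedSum_insert_of_loop`).  If the new label `a ∉ S` is parallel to some
`a' ∈ S` (`ends a = ends a'`) or is a loop (`(ends a).IsDiag`), then for every level `ℓ`
`Σ_{X ⊆ S∪{a}} [ρ X + ρ((S∪{a})∖X) = ℓ] κ(g X, h((S∪{a})∖X))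
   = Σ_{X ⊆ S} [ρ X + ρ(S∖X) = ℓ] κ(g X, h(S∖X)) + Σ_{X ⊆ S} [ρ(X∪{a}) + ρ((S∖X)∪{a}) = ℓ] κ(g(X∪{a}), h((S∖X)∪{a}))`
— for the graded Aas–Gladkov sums of the memos: `AG_ℓ(G) = AG_ℓ(G ∖ a) + AG_ℓ(G / a)` (the second sum is the one of `G` with
`a` forced on both sides, i.e. of the contraction), so every graded antipodal inequality of this shape reduces from
multigraphs to simple graphs.  [this work]
-/

namespace Summit.CriticalPhenomena.PercolationContinuityZ3.Theorems

namespace AntipodalStrongHarris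

open Lab Finset SimpleGraph

variable {k : ℕ} {V : Type*} {ι : Type*} [DecidableEq ι]

/-- Inserting a label parallel to one already present does not change the graph. [this work] -/
theorem graphOf_insert_eq_of_parallel (ends : ι → Sym2 V) {a a' : ι} (hpar : ends a = ends a') {Y : Finset ι}
    (ha' : a' ∈ Y) :
    fromEdgeSet {s : Sym2 V | ∃ i ∈ insert a Y, ends i = s} = fromEdgeSet {s : Sym2 V | ∃ i ∈ Y, ends i = s} := by
  congr 1
  ext s
  simp only [Set.mem_setOf_eq, Finset.mem_insert]
  constructor
  · rintro ⟨i, rfl | hi, he⟩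
    · exact ⟨a', ha', hpar ▸ he⟩
    · exact ⟨i, hi, he⟩
  · rintro ⟨i, hi, he⟩
    exact ⟨i, Or.inr hi, he⟩

/-- Inserting a loop label does not change the graph. [this work] -/
theorem graphOf_insert_eq_of_isDiag (ends : ι → Sym2 V) {a : ι} (hdiag : (ends a).IsDiag) (Y : Finset ι) :
    fromEdgeSet {s : Sym2 V | ∃ i ∈ insert a Y, ends i = s} = fromEdgeSet {s : Sym2 V | ∃ i ∈ Y, ends i = s} := by
  ext v w
  simp only [fromEdgeSet_adj, Set.mem_setOf_eq, Finset.mem_insert, ne_eq]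
  constructor
  · rintro ⟨⟨i, rfl | hi, he⟩, hvw⟩
    · exact absurd (Sym2.mk_isDiag_iff.1 (he ▸ hdiag)) hvw
    · exact ⟨⟨i, hi, he⟩, hvw⟩
  · rintro ⟨⟨i, hi, he⟩, hvw⟩
    exact ⟨⟨i, Or.inr hi, he⟩, hvw⟩

/-- **Parallel labels are additive.**  If `a ∉ S` is parallel to some `a' ∈ S`, the graded antipodal sum over `insert a S`
is the sum over `S` ("`a` deleted") plus the sum over `S` with `a` inserted on both sides ("`a` contracted"), for any rank and
labelings that depend only on the graph. [this work] -/
theorem gradedSum_insert_of_parallel (ends : ι → Sym2 V) {S : Finset ι} {a a' : ι} (ha : a ∉ S) (ha' : a' ∈ S)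
    (hpar : ends a = ends a') (ρ : Finset ι → ℕ) (g h : Finset ι → Lab k)
    (hρ : ∀ Y Y' : Finset ι, fromEdgeSet {s : Sym2 V | ∃ i ∈ Y, ends i = s} =
      fromEdgeSet {s : Sym2 V | ∃ i ∈ Y', ends i = s} → ρ Y = ρ Y')
    (hg : ∀ Y Y' : Finset ι, fromEdgeSet {s : Sym2 V | ∃ i ∈ Y, ends i = s} =
      fromEdgeSet {s : Sym2 V | ∃ i ∈ Y', ends i = s} → g Y = g Y')
    (hh : ∀ Y Y' : Finset ι, fromEdgeSet {s : Sym2 V | ∃ i ∈ Y, ends i = s} =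
      fromEdgeSet {s : Sym2 V | ∃ i ∈ Y', ends i = s} → h Y = h Y')
    (ℓ : ℕ) :
    (∑ X ∈ (insert a S).powerset,
        if ρ X + ρ (insert a S \ X) = ℓ then kappa (g X) (h (insert a S \ X)) else 0) =
      (∑ X ∈ S.powerset, if ρ X + ρ (S \ X) = ℓ then kappa (g X) (h (S \ X)) else 0) +
        ∑ X ∈ S.powerset,
          if ρ (insert a X) + ρ (insert a (S \ X)) = ℓ then
            kappa (g (insert a X)) (h (insert a (S \ X))) else 0 := by
  refine gradedSum_insert_of_spanned ha g h ρ (fun X hX => ?_) ℓ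
  by_cases hX' : a' ∈ X
  · have e := graphOf_insert_eq_of_parallel ends hpar hX'
    exact Or.inl ⟨hρ _ _ e, hg _ _ e, hh _ _ e⟩
  · have e := graphOf_insert_eq_of_parallel ends hpar (Finset.mem_sdiff.2 ⟨ha', hX'⟩ : a' ∈ S \ X)
    exact Or.inr ⟨hρ _ _ e, hg _ _ e, hh _ _ e⟩

/-- **Loops are additive** (and both summands coincide with the sum over `S`): if `ends a` is a diagonal pair, the graded
antipodal sum over `insert a S` is the sum over `S` plus the sum with `a` inserted on both sides. [this work] -/
theorem gradedSum_insert_of_loop (ends : ι → Sym2 V) {S : Finset ι} {a : ι} (ha : a ∉ S) (hdiag : (ends a).IsDiag)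
    (ρ : Finset ι → ℕ) (g h : Finset ι → Lab k)
    (hρ : ∀ Y Y' : Finset ι, fromEdgeSet {s : Sym2 V | ∃ i ∈ Y, ends i = s} =
      fromEdgeSet {s : Sym2 V | ∃ i ∈ Y', ends i = s} → ρ Y = ρ Y')
    (hg : ∀ Y Y' : Finset ι, fromEdgeSet {s : Sym2 V | ∃ i ∈ Y, ends i = s} =
      fromEdgeSet {s : Sym2 V | ∃ i ∈ Y', ends i = s} → g Y = g Y')
    (hh : ∀ Y Y' : Finset ι, fromEdgeSet {s : Sym2 V | ∃ i ∈ Y, ends i = s} =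
      fromEdgeSet {s : Sym2 V | ∃ i ∈ Y', ends i = s} → h Y = h Y')
    (ℓ : ℕ) :
    (∑ X ∈ (insert a S).powerset,
        if ρ X + ρ (insert a S \ X) = ℓ then kappa (g X) (h (insert a S \ X)) else 0) =
      (∑ X ∈ S.powerset, if ρ X + ρ (S \ X) = ℓ then kappa (g X) (h (S \ X)) else 0) +
        ∑ X ∈ S.powerset,
          if ρ (insert a X) + ρ (insert a (S \ X)) = ℓ then
            kappa (g (insert a X)) (h (insert a (S \ X))) else 0 := by
  refine gradedSum_insert_of_spanned ha g h ρ (fun X _ => ?_) ℓ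
  have e := graphOf_insert_eq_of_isDiag ends hdiag X
  exact Or.inl ⟨hρ _ _ e, hg _ _ e, hh _ _ e⟩

end AntipodalStrongHarris

end Summit.CriticalPhenomena.PercolationContinuityZ3.Theorems
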